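import Summits.AtomisticToContinuum.Crystallization.Theorems.OverbindingBudgetPatchTransport

/-!
# OverbindingBudget — two-set patch transport of robust cleanness
(decomp-a2c lens 4, generation 21; helper `--supports stmt-AtomisticToContinuum-31280`; part of the node «RecurrentSeal», whose
statement and reading are in `…Theorems.OverbindingBudgetRecurrentSeal`)

`cleanT_transport₂`: the two-texture form of `…PatchTransport.cleanT_transport` (same proof, bases `b₁` in `A` and `b₂` in `B`): robust
cleanness crosses a fine two-way matching of re-rooted patches between two `δ`-separated textures, with margin loss `2ε`. [folklore]
-/

noncomputable section

namespace Summit.AtomisticToContinuum.Crystallization.Theorems.OverbindingBudgetPatchTransportTwo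

open Filter Metric Set Topology
open Literature.MathematicalPhysics.StatisticalMechanics
open Literature.Geometry.DiscreteGeometry (ShellCloseTo fccKissingPattern hcpKissingPattern EtaMatched
  card_eq_twelve_of_shellCloseTo)
open Summit.AtomisticToContinuum.Crystallization.Theorems.OverbindingBudgetPatchTransport (finite_shell match_unique_src
  match_unique_tgt dist_distort dist_base_le rescale_injective shellCloseTo_image)

/-- **Two-set patch transport of robust cleanness** (the two-texture form of `…PatchTransport.cleanT_transport`, same proof): if the
`R`-patch of `A` about `b₁` and the `R`-patch of `B` about `b₂` are two-way `ε`-matched after re-rooting (`2ε < δ`, both textures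
`δ`-separated, `100 ε ≤ a`), then `t`-robust cleanness of `A` at a site `y` with `dist y b₁ + 2a ≤ R` passes to its partner `y' ∈ B` at every
margin `t'` with `t' + 2ε ≤ t`, `a t' + 2ε ≤ a t`, `-a/50 ≤ t'` (and `0 ≤ t'`, or a lower gap bound on `B`).  Stated on the BODY of `CleanT`
so that the file does not depend on the `CleanT` wrapper. [folklore] -/
theorem cleanT_transport₂ {A B : Set (EuclideanSpace ℝ (Fin 3))} {δ ε R a t t' : ℝ} {b₁ b₂ y y' : (EuclideanSpace ℝ (Fin 3))}
    (hsepA : ∀ x ∈ A, ∀ z ∈ A, x ≠ z → δ ≤ dist x z) (hsepB : ∀ x ∈ B, ∀ z ∈ B, x ≠ z → δ ≤ dist x z) (hε0 : 0 ≤ ε) (hεδ : 2 * ε < δ)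
    (hex₁ : ∀ w ∈ A, dist w b₁ ≤ R → ∃ w' ∈ B, dist (w' - b₂) (w - b₁) ≤ ε)
    (hex₂ : ∀ w' ∈ B, dist w' b₂ ≤ R → ∃ w ∈ A, dist (w' - b₂) (w - b₁) ≤ ε)
    (ha : 0 < a) (hεa : 100 * ε ≤ a) (hlo : -(a / 50) ≤ t') (hhi : t ≤ a / 50)
    (htt : t' + 2 * ε ≤ t) (htta : a * t' + 2 * ε ≤ a * t)
    (hy : y ∈ A) (hy' : y' ∈ B) (hyy' : dist (y' - b₂) (y - b₁) ≤ ε) (hR : dist y b₁ + 2 * a ≤ R)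
    (hthr : 0 ≤ t' ∨ ∀ w' ∈ B, w' ≠ y' → dist y' w' ≤ a * (1 + 1 / 50) ∨ a * (1 + 1 / 50) + 2 * ε < dist y' w')
    (hc : ({w ∈ A | w ≠ y ∧ dist y w ≤ a * (1 + 1 / 50) - t}.ncard = 12 ∧ (∀ w ∈ A, w ≠ y → a * (1 - 1 / 50) + t ≤ dist y w ∧ (dist y w ≤ a * (1 + 1 / 50) - t ∨ a * (63 / 50) + t ≤ dist y w)) ∧ (∃ T : Finset (EuclideanSpace ℝ (Fin 3)), (↑T : Set (EuclideanSpace ℝ (Fin 3))) = (fun w => a⁻¹ • (w - y)) '' {w ∈ A | w ≠ y ∧ dist y w ≤ a * (1 + 1 / 50)} ∧ (Literature.Geometry.DiscreteGeometry.ShellCloseTo (1 / 5 - t) T Literature.Geometry.DiscreteGeometry.fccKissingPattern ∨ Literature.Geometry.DiscreteGeometry.ShellCloseTo (1 / 5 - t) T Literature.Geometry.DiscreteGeometry.hcpKissingPattern)))) :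
    ({w ∈ B | w ≠ y' ∧ dist y' w ≤ a * (1 + 1 / 50) - t'}.ncard = 12 ∧ (∀ w ∈ B, w ≠ y' → a * (1 - 1 / 50) + t' ≤ dist y' w ∧ (dist y' w ≤ a * (1 + 1 / 50) - t' ∨ a * (63 / 50) + t' ≤ dist y' w)) ∧ (∃ T : Finset (EuclideanSpace ℝ (Fin 3)), (↑T : Set (EuclideanSpace ℝ (Fin 3))) = (fun w => a⁻¹ • (w - y')) '' {w ∈ B | w ≠ y' ∧ dist y' w ≤ a * (1 + 1 / 50)} ∧ (Literature.Geometry.DiscreteGeometry.ShellCloseTo (1 / 5 - t') T Literature.Geometry.DiscreteGeometry.fccKissingPattern ∨ Literature.Geometry.DiscreteGeometry.ShellCloseTo (1 / 5 - t') T Literature.Geometry.DiscreteGeometry.hcpKissingPattern))) := by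
  choose! φ hφY hφd using hex₁
  choose! ψ hψY hψd using hex₂
  obtain ⟨hc1, hc2, T, hT, hTP⟩ := hc
  have hδ : 0 < δ := by linarith
  have hUD : UniformlyDiscrete A := ⟨δ, hδ, hsepA⟩
  have hyb : dist y' b₂ ≤ dist y b₁ + ε := dist_base_le hyy'
  -- every point of the source `(1.02a - t)`-shell / target `(1.02a - t')`-shell lies in the matched patch
  have hsrcR : ∀ w ∈ A, dist y w ≤ a * (1 + 1 / 50) - t → dist w b₁ ≤ R := by
    intro w _ hd
    have := dist_triangle w y b₁
    rw [dist_comm w y] at this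
    linarith
  have htgtR : ∀ w' ∈ B, dist y' w' ≤ a * (1 + 1 / 50) - t' → dist w' b₂ ≤ R := by
    intro w' _ hd
    have := dist_triangle w' y' b₂
    rw [dist_comm w' y'] at this
    linarith
  -- (1) the matched image of the source shell is the target shell
  have hAφ : φ '' {w ∈ A | w ≠ y ∧ dist y w ≤ a * (1 + 1 / 50) - t} =
      {w ∈ B | w ≠ y' ∧ dist y' w ≤ a * (1 + 1 / 50) - t'} := by
    apply Set.Subset.antisymm
    · rintro _ ⟨w, ⟨hwY, hwy, hwd⟩, rfl⟩
      have hwR := hsrcR w hwY hwd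
      refine ⟨hφY w hwY hwR, fun heq => hwy ?_, ?_⟩
      · have h1 : dist (φ w - b₂) (y - b₁) ≤ ε := by rw [heq]; exact hyy'
        exact match_unique_src hsepA hεδ hwY hy (hφd w hwY hwR) h1
      · have := (abs_le.1 (dist_distort hyy' (hφd w hwY hwR))).2
        linarith
    · rintro w' ⟨hw'Y, hw'y, hw'd⟩
      have hw'R := htgtR w' hw'Y hw'd
      have hwY := hψY w' hw'Y hw'R
      have hwm := hψd w' hw'Y hw'R
      have hwy : ψ w' ≠ y := by
        intro heq
        apply hw'y
        have h1 : dist (w' - b₂) (y - b₁) ≤ ε := by rw [← heq]; exact hwm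
        exact match_unique_tgt hsepB hεδ hw'Y hy' h1 hyy'
      have hdist := (abs_le.1 (dist_distort hyy' hwm)).1
      have hdyw : dist y (ψ w') ≤ a * (1 + 1 / 50) - t := by
        rcases (hc2 (ψ w') hwY hwy).2 with h | h
        · exact h
        · exfalso; linarith
      have hwR := hsrcR (ψ w') hwY hdyw
      exact ⟨ψ w', ⟨hwY, hwy, hdyw⟩, match_unique_tgt hsepB hεδ (hφY _ hwY hwR) hw'Y (hφd _ hwY hwR) hwm⟩
  have hφinj : Set.InjOn φ {w ∈ A | w ≠ y ∧ dist y w ≤ a * (1 + 1 / 50) - t} := by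
    intro w₁ h₁ w₂ h₂ heq
    have hm₂ : dist (φ w₁ - b₂) (w₂ - b₁) ≤ ε := by rw [heq]; exact hφd w₂ h₂.1 (hsrcR w₂ h₂.1 h₂.2.2)
    exact match_unique_src hsepA hεδ h₁.1 h₂.1 (hφd w₁ h₁.1 (hsrcR w₁ h₁.1 h₁.2.2)) hm₂
  -- (2) window and gap transfer pointwise
  have hc2' : ∀ w' ∈ B, w' ≠ y' → a * (1 - 1 / 50) + t' ≤ dist y' w' ∧
      (dist y' w' ≤ a * (1 + 1 / 50) - t' ∨ a * (63 / 50) + t' ≤ dist y' w') := by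
    intro w' hw'Y hw'y
    by_cases hw'R : dist w' b₂ ≤ R
    · have hwY := hψY w' hw'Y hw'R
      have hwm := hψd w' hw'Y hw'R
      have hwy : ψ w' ≠ y := by
        intro heq
        apply hw'y
        have h1 : dist (w' - b₂) (y - b₁) ≤ ε := by rw [← heq]; exact hwm
        exact match_unique_tgt hsepB hεδ hw'Y hy' h1 hyy'
      have hdist := abs_le.1 (dist_distort hyy' hwm)
      obtain ⟨h1, h2⟩ := hc2 (ψ w') hwY hwy
      refine ⟨by linarith, ?_⟩
      rcases h2 with h | h
      · left; linarith
      · right; linarith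
    · push Not at hw'R
      have := dist_triangle w' y' b₂
      rw [dist_comm w' y'] at this
      exact ⟨by linarith, Or.inr (by linarith)⟩
  -- (3) the exact `1.02a`-shells coincide with the margin shells (source and target)
  have hBA : {w ∈ A | w ≠ y ∧ dist y w ≤ a * (1 + 1 / 50)} = {w ∈ A | w ≠ y ∧ dist y w ≤ a * (1 + 1 / 50) - t} := by
    apply Set.eq_of_subset_of_ncard_le ?_ ?_ (finite_shell hUD y _)
    · rintro w ⟨hwY, hwy, hwd⟩
      refine ⟨hwY, hwy, ?_⟩
      rcases (hc2 w hwY hwy).2 with h | h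
      · exact h
      · exfalso; linarith
    · have h12 : T.card = 12 := card_eq_twelve_of_shellCloseTo hTP
      have hB : ((fun w => a⁻¹ • (w - y)) '' {w ∈ A | w ≠ y ∧ dist y w ≤ a * (1 + 1 / 50)}).ncard = 12 := by
        rw [← hT, Set.ncard_coe_finset, h12]
      rw [Set.ncard_image_of_injective _ (rescale_injective ha.ne' y)] at hB
      rw [hc1, hB]
  have hB'A' : {w ∈ B | w ≠ y' ∧ dist y' w ≤ a * (1 + 1 / 50)} =
      {w ∈ B | w ≠ y' ∧ dist y' w ≤ a * (1 + 1 / 50) - t'} := by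
    apply Set.Subset.antisymm
    · rintro w' ⟨hw'Y, hw'y, hw'd⟩
      refine ⟨hw'Y, hw'y, ?_⟩
      rcases (hc2' w' hw'Y hw'y).2 with h | h
      · exact h
      · exfalso; linarith
    · rintro w' ⟨hw'Y, hw'y, hw'd⟩
      refine ⟨hw'Y, hw'y, ?_⟩
      rcases hthr with h0 | hgap
      · linarith
      · have hw'A : w' ∈ φ '' {w ∈ A | w ≠ y ∧ dist y w ≤ a * (1 + 1 / 50) - t} := by
          rw [hAφ]; exact ⟨hw'Y, hw'y, hw'd⟩
        obtain ⟨w, hwA, rfl⟩ := hw'A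
        have hwB : w ∈ {w ∈ A | w ≠ y ∧ dist y w ≤ a * (1 + 1 / 50)} := by rw [hBA]; exact hwA
        have hdist := (abs_le.1 (dist_distort hyy' (hφd w hwA.1 (hsrcR w hwA.1 hwA.2.2)))).2
        rcases hgap (φ w) hw'Y hw'y with h | h
        · exact h
        · exfalso; linarith [hwB.2.2]
  -- assemble
  refine ⟨?_, hc2', ?_⟩
  · rw [← hAφ, hφinj.ncard_image, hc1]
  · -- (4) the rescaled shell: push `T` forward along `x ↦ a⁻¹ • (φ (y + a • x) - y')`
    classical
    let g : (EuclideanSpace ℝ (Fin 3)) → (EuclideanSpace ℝ (Fin 3)) := fun x => a⁻¹ • (φ (y + a • x) - y')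
    have hback : ∀ w : (EuclideanSpace ℝ (Fin 3)), y + a • (a⁻¹ • (w - y)) = w := by
      intro w
      rw [smul_inv_smul₀ ha.ne']
      abel
    have hmemT : ∀ x ∈ T, ∃ w ∈ {w ∈ A | w ≠ y ∧ dist y w ≤ a * (1 + 1 / 50) - t}, a⁻¹ • (w - y) = x := by
      intro x hx
      have hx' : (x : (EuclideanSpace ℝ (Fin 3))) ∈ (↑T : Set (EuclideanSpace ℝ (Fin 3))) := hx
      rw [hT, hBA] at hx'
      exact hx'
    refine ⟨T.image g, ?_, ?_⟩
    · rw [Finset.coe_image, hT, Set.image_image, hB'A', ← hAφ, Set.image_image, hBA]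
      apply Set.image_congr
      intro w _
      show a⁻¹ • (φ (y + a • (a⁻¹ • (w - y))) - y') = a⁻¹ • (φ w - y')
      rw [hback]
    · have hginj : Set.InjOn g (↑T : Set (EuclideanSpace ℝ (Fin 3))) := by
        intro x₁ hx₁ x₂ hx₂ hgx
        obtain ⟨w₁, hw₁A, rfl⟩ := hmemT x₁ hx₁
        obtain ⟨w₂, hw₂A, rfl⟩ := hmemT x₂ hx₂
        have hgx' : a⁻¹ • (φ w₁ - y') = a⁻¹ • (φ w₂ - y') := by
          have e₁ : g (a⁻¹ • (w₁ - y)) = a⁻¹ • (φ w₁ - y') := by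
            show a⁻¹ • (φ (y + a • (a⁻¹ • (w₁ - y))) - y') = _; rw [hback]
          have e₂ : g (a⁻¹ • (w₂ - y)) = a⁻¹ • (φ w₂ - y') := by
            show a⁻¹ • (φ (y + a • (a⁻¹ • (w₂ - y))) - y') = _; rw [hback]
          rw [← e₁, ← e₂]; exact hgx
        have hφeq : φ w₁ = φ w₂ := rescale_injective ha.ne' y' hgx'
        rw [hφinj hw₁A hw₂A hφeq]
      have hmove : ∀ x ∈ T, dist (g x) x ≤ (1 / 5 - t') - (1 / 5 - t) := by
        intro x hx
        obtain ⟨w, hwA, rfl⟩ := hmemT x hx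
        have hwR := hsrcR w hwA.1 hwA.2.2
        have e₁ : g (a⁻¹ • (w - y)) = a⁻¹ • (φ w - y') := by
          show a⁻¹ • (φ (y + a • (a⁻¹ • (w - y))) - y') = _; rw [hback]
        rw [e₁, dist_smul₀, Real.norm_eq_abs, abs_of_pos (inv_pos.2 ha)]
        have hd : dist (φ w - y') (w - y) ≤ 2 * ε := by
          rw [dist_eq_norm]
          have e2 : φ w - y' - (w - y) = (φ w - b₂ - (w - b₁)) - (y' - b₂ - (y - b₁)) := by abel
          rw [e2]
          calc ‖(φ w - b₂ - (w - b₁)) - (y' - b₂ - (y - b₁))‖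
              ≤ ‖φ w - b₂ - (w - b₁)‖ + ‖y' - b₂ - (y - b₁)‖ := norm_sub_le _ _
            _ ≤ ε + ε := by
                rw [← dist_eq_norm, ← dist_eq_norm]; exact add_le_add (hφd w hwA.1 hwR) hyy'
            _ = 2 * ε := by ring
        have hgoal : a⁻¹ * dist (φ w - y') (w - y) ≤ a⁻¹ * (2 * ε) :=
          mul_le_mul_of_nonneg_left hd (inv_nonneg.2 ha.le)
        have hkey : a⁻¹ * (2 * ε) ≤ t - t' := by
          rw [inv_mul_le_iff₀ ha]
          linarith
        linarith
      rcases hTP with hP | hP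
      · exact Or.inl (shellCloseTo_image hP hginj hmove)
      · exact Or.inr (shellCloseTo_image hP hginj hmove)

end Summit.AtomisticToContinuum.Crystallization.Theorems.OverbindingBudgetPatchTransportTwo

end
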